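import Literature.MathematicalPhysics.QuantumLattice.WilsonLinkFreeDual
import HarnessLib

/-!
# The one-link integral on `U(N)` and `SU(N)`: adjoint symmetry and the determinant-twisted (baryonic) harmonics

Topic `Literature/MathematicalPhysics/QuantumLattice`.  The one-link (Brézin–Gross–Witten / Bars)
integral of lattice gauge theory with an external matrix source,
`oneLinkIntegral ρ J = ∫_G exp(2 Re tr(J ρ(U))) dU` (normalised Haar measure of the compact gauge
group `G` in the matrix representation `ρ`), is DEFINED in `WilsonLinkFreeDual.lean`, together with
`W(0) = 1`, positivity, the bi-invariance `W(ρ(a) J ρ(b)) = W(J)`, continuity in `J`, and the `rfl`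
bridges `oneLinkIntegral_unitaryGroup` / `oneLinkIntegral_specialUnitaryGroup` to
`∫_{U(N)} exp(2 Re tr(J U)) dU` and `∫_{SU(N)} exp(2 Re tr(J U)) dU` (the form in which the route items
on `U(3)` / `SU(3)` are written).  This file continues that API for the unitary groups.

* `oneLinkIntegral_conjTranspose`: for a representation by unitary matrices (`ρ(g⁻¹) = ρ(g)ᴴ`, as
  for `U(N)`, `SU(N)` in the defining representation) `W(Jᴴ) = W(J)` — inversion invariance of the
  Haar measure; this is Creutz's symmetry `W(J, K) = W(K, J)` of the two-source generating function
  `W(J, K) = ∫ exp(tr(J g + K g⁻¹)) dg` (Creutz (8.34)–(8.36)) at `K = Jᴴ`, where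
  `exp(2 Re tr(J g)) = exp(tr(J g) + tr(Jᴴ g⁻¹))`.  In particular Vairinhos–de Forcrand's
  `𝓘_G(J, J†) = oneLinkIntegral ρ Jᴴ` equals `oneLinkIntegral ρ J`.
* `U(N)`: two-sided unitary invariance `W(A J B) = W(J)` (`A, B ∈ U(N)`), hence invariance under a
  central phase `W(z J) = W(J)`, `|z| = 1`; `SU(N)`: two-sided `SU(N)` invariance (Creutz (8.43)).
* `baryonicHarmonic N q J = ∫_{U(N)} (det U)^q exp(2 Re tr(J U)) dU` (`q ∈ ℤ`), the
  DETERMINANT-TWISTED one-link integrals.  In print this is the Leutwyler–Smilga finite-volume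
  effective partition function of QCD in the sector of topological charge `ν = q`,
  `Z_ν = ∫_{U(N_f)} dU (det U)^ν exp(½ tr(M† U + U† M))` (Balantekin 2000, eq. (40); Leutwyler–Smilga
  1992) at `M = 2 Jᴴ`; in the link-free dual of `SU(N)` lattice gauge theory the same integrals are
  the Fourier modes of the `SU(N)` one-link integral along the centre `U(1)` of `U(N)` ("baryonic
  harmonics": `q` units of baryon charge carried by the source, cf. the `(det J)^i` expansion of
  `∫_{SU(n)} exp(tr(J g)) dg`, Creutz (8.44)–(8.49)).  Proved here: `q = 0` is `W_{U(N)}`;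
  `|I_q(J)| ≤ W_{U(N)}(J)`; continuity in `J`; the covariance
  `I_q(A J B) = conj(det A · det B)^q · I_q(J)` under `U(N) × U(N)` (so `SU(N) × SU(N)` invariance and
  the central-phase rule `I_q(z J) = conj(z)^{N q} I_q(J)` — the factor `(det M†)^{-ν}` of Balantekin
  (43)); `conj I_q(J) = I_{-q}(J) = I_q(Jᴴ)`; reality for Hermitian `J`; and the bridge
  `Re I_q(J) = ∫_{U(N)} Re((det U)^q) exp(2 Re tr(J U)) dU` to the integrand of the route item
  `BaryonicHarmonicsNonneg` (`J = diag(s)`).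

* Dependence on `J Jᴴ` only (appended 2026-08-15): `exists_unitaryGroup_eq_mul_of_mul_conjTranspose_eq`
  — `J Jᴴ = K Kᴴ ⟹ K = J U` with `U ∈ U(n)` (isometry extension, Mathlib `LinearIsometry.extend`);
  `exists_unitaryGroup_mul_diagonal_mul` — a singular value decomposition `J = A diag(σ) B`,
  `σᵢ = √λᵢ(J Jᴴ)`, for square complex matrices; hence `W_{U(N)}(J) = W_{U(N)}(K)` whenever
  `J Jᴴ = K Kᴴ` (or `Jᴴ J = Kᴴ K`), `W_{U(N)}(J) = W_{U(N)}(diag(σ))` ("`W` depends on the spectrum of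
  `J J†` only", Creutz (8.43)–(8.44) discussion; Bars 1980), `|I_q(J)| = |I_q(diag(σ))|` and the
  phase–modulus factorisation `I_q(A diag(σ) B) = conj(det A det B)^q I_q(diag(σ))` with
  `I_q(diag(σ))` real.

NOT asserted here (separate results): the `U(N)` character expansion of `W` (Bars 1980;
Balantekin 2000 eqs. (15)–(17), (24)–(26)), the Bessel-determinant evaluation of `Z_ν`
(Balantekin 2000 eqs. (46)–(47)) and the centre-Fourier decomposition
`W_{SU(N)}(J) = Σ_{q ∈ ℤ} I_q(J)`.

## References

* M. Creutz, *Quarks, Gluons and Lattices*, CUP (2022 printing), ch. 8, eqs. (8.34)–(8.49). [Creutz2022]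
* A. B. Balantekin, Phys. Rev. D 62 (2000) 085017, arXiv:hep-th/0007161, §§3, 5. [Balantekin2000]
* H. Leutwyler, A. Smilga, Phys. Rev. D 46 (1992) 5607. [LeutwylerSmilga1992]
* I. Bars, J. Math. Phys. 21 (1980) 2678. [Bars1980]
* H. Vairinhos, Ph. de Forcrand, JHEP 12 (2014) 038, §"0-link action". [VairinhosDeforcrand2014]
-/

noncomputable section

open MeasureTheory
open scoped Matrix ComplexConjugate ComplexOrder

namespace Literature.MathematicalPhysics.QuantumLattice

open QuantumFieldTheory (haarProbability)

/-! ## Adjoint symmetry `W(Jᴴ) = W(J)` for unitary representations -/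

section General

variable {N : ℕ} {G : Type*} [Group G] [TopologicalSpace G] [IsTopologicalGroup G] [CompactSpace G]
  [MeasurableSpace G] [BorelSpace G] (ρ : G →* Matrix (Fin N) (Fin N) ℂ)

/-- **Adjoint symmetry of the one-link integral.**  If `ρ` takes values in unitary matrices in the
sense `ρ(g⁻¹) = ρ(g)ᴴ`, then `W(Jᴴ) = W(J)`: `Re tr(Jᴴ ρ(U)) = Re tr(J ρ(U⁻¹))` and the Haar
probability measure is inversion invariant.  This is Creutz's `W(J, K) = W(K, J)` at `K = Jᴴ`.
[cite: Creutz2022, ch. 8 eq. (8.36)] -/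
theorem oneLinkIntegral_conjTranspose (hρ : ∀ g, ρ g⁻¹ = (ρ g)ᴴ) (J : Matrix (Fin N) (Fin N) ℂ) :
    oneLinkIntegral ρ Jᴴ = oneLinkIntegral ρ J := by
  unfold oneLinkIntegral
  have h : ∀ U : G, (Jᴴ * ρ U).trace.re = (J * ρ U⁻¹).trace.re := fun U => by
    have h1 : ρ U = (ρ U⁻¹)ᴴ := by rw [hρ, Matrix.conjTranspose_conjTranspose]
    rw [h1, ← Matrix.conjTranspose_mul, Matrix.trace_conjTranspose, Matrix.trace_mul_comm,
      Complex.star_def, Complex.conj_re]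
  simp_rw [h]
  exact integral_inv_eq_self (fun U : G => Real.exp (2 * (J * ρ U).trace.re)) (haarProbability G)

end General

/-! ## `U(N)` and `SU(N)` in the defining representation -/

section Unitary

variable {N : ℕ}

/-- The defining representation of `U(N)` is unitary: `ρ(U⁻¹) = ρ(U)ᴴ`. [folklore] -/
theorem unitaryFundamentalRep_inv (U : Matrix.unitaryGroup (Fin N) ℂ) :
    unitaryFundamentalRep (Fin N) ℂ U⁻¹ = (unitaryFundamentalRep (Fin N) ℂ U)ᴴ := rfl

/-- The defining representation of `SU(N)` is unitary: `ρ(U⁻¹) = ρ(U)ᴴ`. [folklore] -/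
theorem fundamentalRep_inv (U : Matrix.specialUnitaryGroup (Fin N) ℂ) :
    fundamentalRep (Fin N) U⁻¹ = (fundamentalRep (Fin N) U)ᴴ := by
  rw [← Matrix.star_eq_inv]; rfl

/-- `W_{U(N)}(Jᴴ) = W_{U(N)}(J)`. [cite: Creutz2022, ch. 8 eq. (8.36)] -/
theorem oneLinkIntegral_unitaryGroup_conjTranspose (J : Matrix (Fin N) (Fin N) ℂ) :
    oneLinkIntegral (unitaryFundamentalRep (Fin N) ℂ) Jᴴ =
      oneLinkIntegral (unitaryFundamentalRep (Fin N) ℂ) J :=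
  oneLinkIntegral_conjTranspose _ unitaryFundamentalRep_inv J

/-- `W_{SU(N)}(Jᴴ) = W_{SU(N)}(J)`. [cite: Creutz2022, ch. 8 eq. (8.36)] -/
theorem oneLinkIntegral_specialUnitaryGroup_conjTranspose (J : Matrix (Fin N) (Fin N) ℂ) :
    oneLinkIntegral (fundamentalRep (Fin N)) Jᴴ = oneLinkIntegral (fundamentalRep (Fin N)) J :=
  oneLinkIntegral_conjTranspose _ fundamentalRep_inv J

/-- **Two-sided unitary invariance** of the `U(N)` one-link integral: `W(A J B) = W(J)` for
`A, B ∈ U(N)` (`oneLinkIntegral_conj` in the defining representation). [cite: Creutz2022, ch. 8 eq. (8.43)] -/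
theorem oneLinkIntegral_unitaryGroup_mul_mul (A B : Matrix.unitaryGroup (Fin N) ℂ)
    (J : Matrix (Fin N) (Fin N) ℂ) :
    oneLinkIntegral (unitaryFundamentalRep (Fin N) ℂ)
        ((A : Matrix (Fin N) (Fin N) ℂ) * J * (B : Matrix (Fin N) (Fin N) ℂ)) =
      oneLinkIntegral (unitaryFundamentalRep (Fin N) ℂ) J :=
  oneLinkIntegral_conj _ J A B

/-- **Two-sided `SU(N)` invariance** of the `SU(N)` one-link integral: `W(A J B) = W(J)` for
`A, B ∈ SU(N)`. [cite: Creutz2022, ch. 8 eq. (8.43)] -/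
theorem oneLinkIntegral_specialUnitaryGroup_mul_mul (A B : Matrix.specialUnitaryGroup (Fin N) ℂ)
    (J : Matrix (Fin N) (Fin N) ℂ) :
    oneLinkIntegral (fundamentalRep (Fin N))
        ((A : Matrix (Fin N) (Fin N) ℂ) * J * (B : Matrix (Fin N) (Fin N) ℂ)) =
      oneLinkIntegral (fundamentalRep (Fin N)) J :=
  oneLinkIntegral_conj _ J A B

/-- A unit complex number as a central element `z • 1` of `U(N)`. [folklore] -/
def unitaryGroupScalar (N : ℕ) (z : ℂ) (hz : z ∈ unitary ℂ) : Matrix.unitaryGroup (Fin N) ℂ :=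
  ⟨z • (1 : Matrix (Fin N) (Fin N) ℂ), by
    rw [Matrix.mem_unitaryGroup_iff, star_smul, star_one, Matrix.smul_mul, Matrix.one_mul, smul_smul,
      Unitary.mul_star_self_of_mem hz, one_smul]⟩

/-- The matrix of the central element `z • 1`. [folklore] -/
@[simp] theorem coe_unitaryGroupScalar (z : ℂ) (hz : z ∈ unitary ℂ) :
    (unitaryGroupScalar N z hz : Matrix (Fin N) (Fin N) ℂ) = z • (1 : Matrix (Fin N) (Fin N) ℂ) := rfl

/-- **Central-phase invariance** of the `U(N)` one-link integral: `W(z J) = W(J)` for `|z| = 1`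
(`z • 1 ∈ U(N)` and left invariance).  (For `SU(N)` this only holds when `z^N = 1`; the general phase
dependence of `W_{SU(N)}` is carried by the baryonic harmonics below.) [folklore] -/
theorem oneLinkIntegral_unitaryGroup_smul (z : ℂ) (hz : z ∈ unitary ℂ) (J : Matrix (Fin N) (Fin N) ℂ) :
    oneLinkIntegral (unitaryFundamentalRep (Fin N) ℂ) (z • J) =
      oneLinkIntegral (unitaryFundamentalRep (Fin N) ℂ) J := by
  have h := oneLinkIntegral_unitaryGroup_mul_mul (unitaryGroupScalar N z hz) 1 J
  simpa only [coe_unitaryGroupScalar, Matrix.smul_mul, Matrix.one_mul, Submonoid.coe_one,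
    Matrix.mul_one] using h

/-! ## The determinant-twisted one-link integrals (baryonic harmonics) -/

/-- The determinant of a unitary matrix is a unit complex number. [folklore] -/
theorem det_coe_unitaryGroup_mem_unitary (U : Matrix.unitaryGroup (Fin N) ℂ) :
    (U : Matrix (Fin N) (Fin N) ℂ).det ∈ unitary ℂ :=
  Matrix.det_of_mem_unitary U.2

/-- `|det U| = 1` for `U ∈ U(N)`. [folklore] -/
theorem norm_det_coe_unitaryGroup (U : Matrix.unitaryGroup (Fin N) ℂ) :
    ‖(U : Matrix (Fin N) (Fin N) ℂ).det‖ = 1 :=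
  CStarRing.norm_of_mem_unitary (det_coe_unitaryGroup_mem_unitary U)

/-- `det U ≠ 0` for `U ∈ U(N)`. [folklore] -/
theorem det_coe_unitaryGroup_ne_zero (U : Matrix.unitaryGroup (Fin N) ℂ) :
    (U : Matrix (Fin N) (Fin N) ℂ).det ≠ 0 := by
  intro h
  have := norm_det_coe_unitaryGroup U
  rw [h, norm_zero] at this
  exact zero_ne_one this

/-- `conj(det U) = (det U)⁻¹` for `U ∈ U(N)`. [folklore] -/
theorem star_det_coe_unitaryGroup (U : Matrix.unitaryGroup (Fin N) ℂ) :
    star (U : Matrix (Fin N) (Fin N) ℂ).det = ((U : Matrix (Fin N) (Fin N) ℂ).det)⁻¹ :=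
  eq_inv_of_mul_eq_one_left (Unitary.star_mul_self_of_mem (det_coe_unitaryGroup_mem_unitary U))

/-- `det(U⁻¹) = (det U)⁻¹` in `U(N)` (`U⁻¹ = Uᴴ`). [folklore] -/
theorem det_coe_inv_unitaryGroup (U : Matrix.unitaryGroup (Fin N) ℂ) :
    ((U⁻¹ : Matrix.unitaryGroup (Fin N) ℂ) : Matrix (Fin N) (Fin N) ℂ).det =
      ((U : Matrix (Fin N) (Fin N) ℂ).det)⁻¹ := by
  rw [Matrix.UnitaryGroup.inv_val, Matrix.star_eq_conjTranspose, Matrix.det_conjTranspose,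
    star_det_coe_unitaryGroup]

variable (N) in
/-- The **determinant-twisted one-link integral** ("baryonic harmonic" of charge `q ∈ ℤ`) of `U(N)`
with matrix source `J`:
`I_q(J) = ∫_{U(N)} (det U)^q · exp(2 Re tr(J U)) dU` (normalised Haar measure).  For `q = 0` this is
the one-link integral `W_{U(N)}(J)` (`baryonicHarmonic_zero`).  In print it is the Leutwyler–Smilga
finite-volume effective partition function in the sector of topological charge `ν = q`,
`Z_ν(M) = ∫_{U(N_f)} dU (det U)^ν exp(½ tr(M† U + U† M))`, at `M = 2 Jᴴ` (since
`2 Re tr(J U) = tr(J U) + tr(U† Jᴴ)`); Balantekin evaluates it by the `U(N)` character expansion as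
`(det M†)^{-ν} ×` (a series in the characters `χ_r(M† M)`), eq. (43), and in closed Bessel-determinant
form, eqs. (46)–(47) — neither evaluation is asserted here.
[cite: Balantekin2000, §5 eq. (40)] -/
def baryonicHarmonic (q : ℤ) (J : Matrix (Fin N) (Fin N) ℂ) : ℂ :=
  ∫ U, (U : Matrix (Fin N) (Fin N) ℂ).det ^ q *
      (Real.exp (2 * (J * (U : Matrix (Fin N) (Fin N) ℂ)).trace.re) : ℂ)
    ∂haarProbability (Matrix.unitaryGroup (Fin N) ℂ)

/-- Unfolding lemma. [folklore] -/
theorem baryonicHarmonic_def (q : ℤ) (J : Matrix (Fin N) (Fin N) ℂ) :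
    baryonicHarmonic N q J = ∫ U, (U : Matrix (Fin N) (Fin N) ℂ).det ^ q *
      (Real.exp (2 * (J * (U : Matrix (Fin N) (Fin N) ℂ)).trace.re) : ℂ)
        ∂haarProbability (Matrix.unitaryGroup (Fin N) ℂ) := rfl

/-- The twisted integrand `(J, U) ↦ (det U)^q exp(2 Re tr(J U))` is jointly continuous. [folklore] -/
theorem continuous_baryonicIntegrand (q : ℤ) :
    Continuous (Function.uncurry fun (J : Matrix (Fin N) (Fin N) ℂ)
      (U : Matrix.unitaryGroup (Fin N) ℂ) => (U : Matrix (Fin N) (Fin N) ℂ).det ^ q *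
        (Real.exp (2 * (J * (U : Matrix (Fin N) (Fin N) ℂ)).trace.re) : ℂ)) := by
  have hdet : Continuous fun p : Matrix (Fin N) (Fin N) ℂ × Matrix.unitaryGroup (Fin N) ℂ =>
      (p.2 : Matrix (Fin N) (Fin N) ℂ).det ^ q :=
    ((continuous_subtype_val.comp continuous_snd).matrix_det).zpow₀ q
      fun p => Or.inl (det_coe_unitaryGroup_ne_zero p.2)
  have hexp := continuous_oneLinkIntegrand (unitaryFundamentalRep (Fin N) ℂ) continuous_subtype_val
  exact hdet.mul (Complex.continuous_ofReal.comp hexp)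

/-- For fixed `J` the twisted integrand is continuous on `U(N)`. [folklore] -/
theorem continuous_baryonicIntegrand_right (q : ℤ) (J : Matrix (Fin N) (Fin N) ℂ) :
    Continuous fun U : Matrix.unitaryGroup (Fin N) ℂ => (U : Matrix (Fin N) (Fin N) ℂ).det ^ q *
        (Real.exp (2 * (J * (U : Matrix (Fin N) (Fin N) ℂ)).trace.re) : ℂ) :=
  (continuous_baryonicIntegrand q).comp (Continuous.prodMk_right J)

/-- The twisted integrand is Haar integrable (continuous on a compact group). [folklore] -/
theorem integrable_baryonicIntegrand (q : ℤ) (J : Matrix (Fin N) (Fin N) ℂ) :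
    Integrable (fun U : Matrix.unitaryGroup (Fin N) ℂ => (U : Matrix (Fin N) (Fin N) ℂ).det ^ q *
        (Real.exp (2 * (J * (U : Matrix (Fin N) (Fin N) ℂ)).trace.re) : ℂ))
      (haarProbability (Matrix.unitaryGroup (Fin N) ℂ)) :=
  (continuous_baryonicIntegrand_right q J).integrable_of_hasCompactSupport
    (HasCompactSupport.of_compactSpace _)

/-- Pointwise modulus of the twisted integrand: `|(det U)^q e^{2 Re tr(J U)}| = e^{2 Re tr(J U)}`.
[folklore] -/
theorem norm_baryonicIntegrand (q : ℤ) (J : Matrix (Fin N) (Fin N) ℂ)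
    (U : Matrix.unitaryGroup (Fin N) ℂ) :
    ‖(U : Matrix (Fin N) (Fin N) ℂ).det ^ q *
        (Real.exp (2 * (J * (U : Matrix (Fin N) (Fin N) ℂ)).trace.re) : ℂ)‖ =
      Real.exp (2 * (J * (U : Matrix (Fin N) (Fin N) ℂ)).trace.re) := by
  rw [norm_mul, norm_zpow, norm_det_coe_unitaryGroup, one_zpow, one_mul, Complex.norm_real,
    Real.norm_eq_abs, abs_of_pos (Real.exp_pos _)]

/-- **`q = 0` is the one-link integral**: `I_0(J) = W_{U(N)}(J)`. [cite: Balantekin2000, §5 eq. (40)] -/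
theorem baryonicHarmonic_zero (J : Matrix (Fin N) (Fin N) ℂ) :
    baryonicHarmonic N 0 J = (oneLinkIntegral (unitaryFundamentalRep (Fin N) ℂ) J : ℂ) := by
  unfold baryonicHarmonic oneLinkIntegral
  simp only [zpow_zero, one_mul]
  rw [integral_complex_ofReal]
  rfl

/-- **Domination by the one-link integral**: `|I_q(J)| ≤ W_{U(N)}(J)` (`|det U| = 1`). [folklore] -/
theorem norm_baryonicHarmonic_le (q : ℤ) (J : Matrix (Fin N) (Fin N) ℂ) :
    ‖baryonicHarmonic N q J‖ ≤ oneLinkIntegral (unitaryFundamentalRep (Fin N) ℂ) J := by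
  unfold baryonicHarmonic oneLinkIntegral
  refine (norm_integral_le_integral_norm _).trans (le_of_eq ?_)
  simp_rw [norm_baryonicIntegrand]
  rfl

/-- **Continuity** of `J ↦ I_q(J)` (parametric integral of a jointly continuous integrand over a
compact group). [folklore] -/
theorem continuous_baryonicHarmonic (q : ℤ) : Continuous (baryonicHarmonic N q) := by
  haveI : FirstCountableTopology (Matrix (Fin N) (Fin N) ℂ) :=
    inferInstanceAs (FirstCountableTopology (Fin N → Fin N → ℂ))
  haveI : LocallyCompactSpace (Matrix (Fin N) (Fin N) ℂ) :=
    inferInstanceAs (LocallyCompactSpace (Fin N → Fin N → ℂ))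
  have h := continuous_parametric_integral_of_continuous
    (μ := haarProbability (Matrix.unitaryGroup (Fin N) ℂ)) (continuous_baryonicIntegrand (N := N) q)
    isCompact_univ
  simp only [Measure.restrict_univ] at h
  exact h

/-- **`U(N) × U(N)` covariance by the determinant character**:
`I_q(A J B) = conj(det A · det B)^q · I_q(J)` for `A, B ∈ U(N)` — substitute `U ↦ B U A` in the
bi-invariant Haar integral and use `det U = det(B U A) · conj(det A det B)`.  This is the factor
`(det M†)^{-ν}` in Balantekin's evaluation. [cite: Balantekin2000, §5 eq. (43)] -/
theorem baryonicHarmonic_unitary_mul_mul (A B : Matrix.unitaryGroup (Fin N) ℂ) (q : ℤ)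
    (J : Matrix (Fin N) (Fin N) ℂ) :
    baryonicHarmonic N q ((A : Matrix (Fin N) (Fin N) ℂ) * J * (B : Matrix (Fin N) (Fin N) ℂ)) =
      star ((A : Matrix (Fin N) (Fin N) ℂ).det * (B : Matrix (Fin N) (Fin N) ℂ).det) ^ q *
        baryonicHarmonic N q J := by
  unfold baryonicHarmonic
  set φ : Matrix.unitaryGroup (Fin N) ℂ → ℂ := fun U => (U : Matrix (Fin N) (Fin N) ℂ).det ^ q *
      (Real.exp (2 * (J * (U : Matrix (Fin N) (Fin N) ℂ)).trace.re) : ℂ) with hφ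
  have key : ∀ U : Matrix.unitaryGroup (Fin N) ℂ,
      (U : Matrix (Fin N) (Fin N) ℂ).det ^ q *
        (Real.exp (2 * ((A : Matrix (Fin N) (Fin N) ℂ) * J * (B : Matrix (Fin N) (Fin N) ℂ) *
          (U : Matrix (Fin N) (Fin N) ℂ)).trace.re) : ℂ) =
      star ((A : Matrix (Fin N) (Fin N) ℂ).det * (B : Matrix (Fin N) (Fin N) ℂ).det) ^ q *
        φ (B * U * A) := by
    intro U
    have hA := star_det_coe_unitaryGroup A
    have hB := star_det_coe_unitaryGroup B
    have hA0 := det_coe_unitaryGroup_ne_zero A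
    have hB0 := det_coe_unitaryGroup_ne_zero B
    have hdet : (U : Matrix (Fin N) (Fin N) ℂ).det =
        star ((A : Matrix (Fin N) (Fin N) ℂ).det * (B : Matrix (Fin N) (Fin N) ℂ).det) *
          ((B * U * A : Matrix.unitaryGroup (Fin N) ℂ) : Matrix (Fin N) (Fin N) ℂ).det := by
      rw [star_mul', hA, hB, Submonoid.coe_mul, Submonoid.coe_mul, Matrix.det_mul, Matrix.det_mul]
      field_simp
    have htr : ((A : Matrix (Fin N) (Fin N) ℂ) * J * (B : Matrix (Fin N) (Fin N) ℂ) *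
          (U : Matrix (Fin N) (Fin N) ℂ)).trace =
        (J * ((B * U * A : Matrix.unitaryGroup (Fin N) ℂ) : Matrix (Fin N) (Fin N) ℂ)).trace := by
      rw [Submonoid.coe_mul, Submonoid.coe_mul]
      simp only [Matrix.mul_assoc]
      rw [Matrix.trace_mul_comm]
      simp only [Matrix.mul_assoc]
    rw [hdet, htr, mul_zpow, hφ, mul_assoc]
  simp_rw [key]
  rw [integral_const_mul]
  congr 1
  exact QuantumFieldTheory.integral_haar_conj_eq φ B A

/-- **Two-sided `SU(N)` invariance**: `I_q(A J B) = I_q(J)` for `A, B ∈ SU(N)`. [folklore] -/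
theorem baryonicHarmonic_specialUnitary_mul_mul (A B : Matrix.specialUnitaryGroup (Fin N) ℂ) (q : ℤ)
    (J : Matrix (Fin N) (Fin N) ℂ) :
    baryonicHarmonic N q ((A : Matrix (Fin N) (Fin N) ℂ) * J * (B : Matrix (Fin N) (Fin N) ℂ)) =
      baryonicHarmonic N q J := by
  obtain ⟨hAu, hAd⟩ := Matrix.mem_specialUnitaryGroup_iff.1 A.2
  obtain ⟨hBu, hBd⟩ := Matrix.mem_specialUnitaryGroup_iff.1 B.2
  have h := baryonicHarmonic_unitary_mul_mul ⟨(A : Matrix (Fin N) (Fin N) ℂ), hAu⟩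
    ⟨(B : Matrix (Fin N) (Fin N) ℂ), hBu⟩ q J
  simp only [hAd, hBd, mul_one, star_one, one_zpow, one_mul] at h
  exact h

/-- **Central-phase covariance**: `I_q(z J) = conj(z)^{N q} · I_q(J)` for `|z| = 1`
(`z • 1 ∈ U(N)` has determinant `z^N`).  With `J = e^{iθ} P` this is the phase factor
`e^{-i q N θ} = e^{-i q arg det J}` multiplying a function of the singular values. [folklore] -/
theorem baryonicHarmonic_smul (z : ℂ) (hz : z ∈ unitary ℂ) (q : ℤ) (J : Matrix (Fin N) (Fin N) ℂ) :
    baryonicHarmonic N q (z • J) = star z ^ ((N : ℤ) * q) * baryonicHarmonic N q J := by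
  have h := baryonicHarmonic_unitary_mul_mul (unitaryGroupScalar N z hz) 1 q J
  simp only [coe_unitaryGroupScalar, Matrix.smul_mul, Matrix.one_mul, Submonoid.coe_one,
    Matrix.det_one, mul_one] at h
  rw [h, Matrix.det_smul, Matrix.det_one, mul_one, Fintype.card_fin, star_pow, zpow_mul, zpow_natCast]

/-- **Complex conjugation lowers the charge**: `conj I_q(J) = I_{-q}(J)`
(`conj((det U)^q) = (det U)^{-q}` on `U(N)`). [folklore] -/
theorem star_baryonicHarmonic (q : ℤ) (J : Matrix (Fin N) (Fin N) ℂ) :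
    star (baryonicHarmonic N q J) = baryonicHarmonic N (-q) J := by
  unfold baryonicHarmonic
  rw [Complex.star_def, ← integral_conj]
  refine integral_congr_ae (Filter.Eventually.of_forall fun U => ?_)
  simp only [map_mul, Complex.conj_ofReal, map_zpow₀]
  rw [← Complex.star_def, star_det_coe_unitaryGroup, inv_zpow, ← zpow_neg]

/-- **Charge reversal is the adjoint source**: `I_{-q}(J) = I_q(Jᴴ)` (substitute `U ↦ U⁻¹ = Uᴴ`:
`det(U⁻¹)^q = (det U)^{-q}` and `Re tr(Jᴴ Uᴴ) = Re tr(J U)`).  Cf. Balantekin's use of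
`det U† = (det U)⁻¹` between eqs. (21) and (21a). [cite: Balantekin2000, §3 eqs. (21)–(21a)] -/
theorem baryonicHarmonic_neg (q : ℤ) (J : Matrix (Fin N) (Fin N) ℂ) :
    baryonicHarmonic N (-q) J = baryonicHarmonic N q Jᴴ := by
  unfold baryonicHarmonic
  have h : ∀ U : Matrix.unitaryGroup (Fin N) ℂ,
      (U : Matrix (Fin N) (Fin N) ℂ).det ^ (-q) *
        (Real.exp (2 * (J * (U : Matrix (Fin N) (Fin N) ℂ)).trace.re) : ℂ) =
      ((U⁻¹ : Matrix.unitaryGroup (Fin N) ℂ) : Matrix (Fin N) (Fin N) ℂ).det ^ q *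
        (Real.exp (2 * (Jᴴ * ((U⁻¹ : Matrix.unitaryGroup (Fin N) ℂ) :
          Matrix (Fin N) (Fin N) ℂ)).trace.re) : ℂ) := by
    intro U
    rw [det_coe_inv_unitaryGroup, inv_zpow, ← zpow_neg, Matrix.UnitaryGroup.inv_val,
      Matrix.star_eq_conjTranspose, ← Matrix.conjTranspose_mul, Matrix.trace_conjTranspose,
      Matrix.trace_mul_comm, Complex.star_def, Complex.conj_re]
  simp_rw [h]
  exact integral_inv_eq_self (fun U : Matrix.unitaryGroup (Fin N) ℂ =>
    (U : Matrix (Fin N) (Fin N) ℂ).det ^ q *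
      (Real.exp (2 * (Jᴴ * (U : Matrix (Fin N) (Fin N) ℂ)).trace.re) : ℂ))
    (haarProbability (Matrix.unitaryGroup (Fin N) ℂ))

/-- `conj I_q(J) = I_q(Jᴴ)`. [folklore] -/
theorem star_baryonicHarmonic_eq_conjTranspose (q : ℤ) (J : Matrix (Fin N) (Fin N) ℂ) :
    star (baryonicHarmonic N q J) = baryonicHarmonic N q Jᴴ := by
  rw [star_baryonicHarmonic, baryonicHarmonic_neg]

/-- **Reality for Hermitian sources**: if `Jᴴ = J` (e.g. `J = diag(s)` with real `s`, or `J`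
positive semidefinite) then `I_q(J)` is real. [folklore] -/
theorem baryonicHarmonic_im_of_conjTranspose_eq (q : ℤ) {J : Matrix (Fin N) (Fin N) ℂ}
    (hJ : Jᴴ = J) : (baryonicHarmonic N q J).im = 0 := by
  have h := star_baryonicHarmonic_eq_conjTranspose q J
  rw [hJ, Complex.star_def] at h
  exact Complex.conj_eq_iff_im.1 h

/-- For Hermitian `J` the harmonics are even in the charge: `I_{-q}(J) = I_q(J)`. [folklore] -/
theorem baryonicHarmonic_neg_of_conjTranspose_eq (q : ℤ) {J : Matrix (Fin N) (Fin N) ℂ}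
    (hJ : Jᴴ = J) : baryonicHarmonic N (-q) J = baryonicHarmonic N q J := by
  rw [baryonicHarmonic_neg, hJ]

/-- **Bridge to the real form** used by the route item `BaryonicHarmonicsNonneg`
(`Summits/QuantumFields/QCD`): for `q ∈ ℕ`,
`Re I_q(J) = ∫_{U(N)} Re((det U)^q) · exp(2 Re tr(J U)) dU`. [folklore] -/
theorem re_baryonicHarmonic_natCast (q : ℕ) (J : Matrix (Fin N) (Fin N) ℂ) :
    (baryonicHarmonic N q J).re = ∫ U, ((U : Matrix (Fin N) (Fin N) ℂ).det ^ q).re *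
        Real.exp (2 * (J * (U : Matrix (Fin N) (Fin N) ℂ)).trace.re)
      ∂haarProbability (Matrix.unitaryGroup (Fin N) ℂ) := by
  unfold baryonicHarmonic
  have hint := integrable_baryonicIntegrand (N := N) (q : ℤ) J
  rw [← Complex.reCLM_apply, ← ContinuousLinearMap.integral_comp_comm _ hint]
  refine integral_congr_ae (Filter.Eventually.of_forall fun U => ?_)
  simp only [Complex.reCLM_apply, zpow_natCast, Complex.re_mul_ofReal]

/-- The same bridge for `q ∈ ℤ`. [folklore] -/
theorem re_baryonicHarmonic (q : ℤ) (J : Matrix (Fin N) (Fin N) ℂ) :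
    (baryonicHarmonic N q J).re = ∫ U, ((U : Matrix (Fin N) (Fin N) ℂ).det ^ q).re *
        Real.exp (2 * (J * (U : Matrix (Fin N) (Fin N) ℂ)).trace.re)
      ∂haarProbability (Matrix.unitaryGroup (Fin N) ℂ) := by
  unfold baryonicHarmonic
  have hint := integrable_baryonicIntegrand (N := N) q J
  rw [← Complex.reCLM_apply, ← ContinuousLinearMap.integral_comp_comm _ hint]
  refine integral_congr_ae (Filter.Eventually.of_forall fun U => ?_)
  simp only [Complex.reCLM_apply, Complex.re_mul_ofReal]

end Unitary

/-! ## Dependence on `J Jᴴ` only: unitary freedom, singular values -/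

section GramFactor

open scoped InnerProductSpace

variable {n : Type*} [Fintype n] [DecidableEq n]

/-- **Unitary freedom of a Gram factorisation.**  If two square complex matrices have the same
row Gram matrix, `J Jᴴ = K Kᴴ`, then `K = J U` for a unitary `U`: the assignment `Jᴴ x ↦ Kᴴ x` is a
well-defined isometry of `range Jᴴ ⊆ ℂⁿ` into `ℂⁿ` (`‖Jᴴ x‖² = ⟨x, J Jᴴ x⟩ = ‖Kᴴ x‖²`), it extends
to a unitary `u` of `ℂⁿ` (Mathlib's `LinearIsometry.extend`), and then `Kᴴ = u Jᴴ`, `K = J u†`.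
(The uniqueness half of the polar decomposition; no singular value decomposition is available in
Mathlib at the time of writing.) [folklore] -/
theorem exists_unitaryGroup_eq_mul_of_mul_conjTranspose_eq (J K : Matrix n n ℂ)
    (h : J * Jᴴ = K * Kᴴ) : ∃ U : Matrix.unitaryGroup n ℂ, K = J * (U : Matrix n n ℂ) := by
  -- the operators of `J`, `K` on `ℂⁿ = EuclideanSpace ℂ n`
  set F : EuclideanSpace ℂ n →L[ℂ] EuclideanSpace ℂ n := Matrix.toEuclideanCLM (n := n) (𝕜 := ℂ) J
    with hF
  set G : EuclideanSpace ℂ n →L[ℂ] EuclideanSpace ℂ n := Matrix.toEuclideanCLM (n := n) (𝕜 := ℂ) K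
    with hG
  have hFG : F * star F = G * star G := by
    rw [hF, hG, ← map_star, ← map_mul, ← map_star, ← map_mul, Matrix.star_eq_conjTranspose,
      Matrix.star_eq_conjTranspose, h]
  -- `‖F† x‖ = ‖G† x‖`
  have key : ∀ (T : EuclideanSpace ℂ n →L[ℂ] EuclideanSpace ℂ n) (x : EuclideanSpace ℂ n),
      ‖(star T) x‖ ^ 2 = RCLike.re ⟪(T * star T) x, x⟫_ℂ := fun T x => by
    rw [ContinuousLinearMap.star_eq_adjoint, ContinuousLinearMap.apply_norm_sq_eq_inner_adjoint_left,
      ContinuousLinearMap.adjoint_adjoint, ContinuousLinearMap.mul_def]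
  have hnorm : ∀ x, ‖(star F) x‖ = ‖(star G) x‖ := fun x => by
    have h2 : ‖(star F) x‖ ^ 2 = ‖(star G) x‖ ^ 2 := by rw [key, key, hFG]
    exact (sq_eq_sq₀ (norm_nonneg _) (norm_nonneg _)).1 h2
  -- the isometry `F† x ↦ G† x` of `range F†` into `ℂⁿ`
  set f : EuclideanSpace ℂ n →ₗ[ℂ] EuclideanSpace ℂ n :=
    ((star F : EuclideanSpace ℂ n →L[ℂ] EuclideanSpace ℂ n) : EuclideanSpace ℂ n →ₗ[ℂ] EuclideanSpace ℂ n)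
    with hf
  set g : EuclideanSpace ℂ n →ₗ[ℂ] EuclideanSpace ℂ n :=
    ((star G : EuclideanSpace ℂ n →L[ℂ] EuclideanSpace ℂ n) : EuclideanSpace ℂ n →ₗ[ℂ] EuclideanSpace ℂ n)
    with hg
  have hfg : ∀ x, ‖f x‖ = ‖g x‖ := hnorm
  have hker : LinearMap.ker f ≤ LinearMap.ker g := fun x hx => by
    rw [LinearMap.mem_ker] at hx ⊢
    rw [← norm_eq_zero, ← hfg x, hx, norm_zero]
  set L₀ : LinearMap.range f →ₗ[ℂ] EuclideanSpace ℂ n :=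
    ((LinearMap.ker f).liftQ g hker).comp (f.quotKerEquivRange.symm : LinearMap.range f →ₗ[ℂ] _)
    with hL₀
  have hL₀f : ∀ x, L₀ ⟨f x, LinearMap.mem_range_self f x⟩ = g x := fun x => by
    rw [hL₀, LinearMap.comp_apply, LinearEquiv.coe_coe, LinearMap.quotKerEquivRange_symm_apply_image,
      Submodule.mkQ_apply, Submodule.liftQ_apply]
  have hL₀iso : ∀ y : LinearMap.range f, ‖L₀ y‖ = ‖y‖ := by
    rintro ⟨_, x, rfl⟩
    rw [hL₀f x, ← hfg x]
    rfl
  let L : LinearMap.range f →ₗᵢ[ℂ] EuclideanSpace ℂ n := ⟨L₀, hL₀iso⟩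
  -- extend to a unitary `u = L.extend` of `ℂⁿ`
  have hu : ∀ x, L.extend (f x) = g x := fun x => by
    have := L.extend_apply ⟨f x, LinearMap.mem_range_self f x⟩
    rw [Submodule.coe_mk] at this
    rw [this]
    exact hL₀f x
  let e : EuclideanSpace ℂ n ≃ₗᵢ[ℂ] EuclideanSpace ℂ n := L.extend.toLinearIsometryEquiv rfl
  let w : unitary (EuclideanSpace ℂ n →L[ℂ] EuclideanSpace ℂ n) := Unitary.linearIsometryEquiv.symm e
  have hw : ∀ x, (w : EuclideanSpace ℂ n →L[ℂ] EuclideanSpace ℂ n) x = L.extend x := fun x => by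
    simp only [w, Unitary.coe_symm_linearIsometryEquiv_apply, e]
    rfl
  -- back to matrices
  set M : Matrix n n ℂ := (Matrix.toEuclideanCLM (n := n) (𝕜 := ℂ)).symm
    (w : EuclideanSpace ℂ n →L[ℂ] EuclideanSpace ℂ n) with hM
  have hMw : Matrix.toEuclideanCLM (n := n) (𝕜 := ℂ) M = (w : EuclideanSpace ℂ n →L[ℂ] _) := by
    rw [hM, StarAlgEquiv.apply_symm_apply]
  have hMu : M ∈ Matrix.unitaryGroup n ℂ := by
    rw [Matrix.mem_unitaryGroup_iff']
    apply EquivLike.injective (Matrix.toEuclideanCLM (n := n) (𝕜 := ℂ))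
    rw [map_mul, map_star, hMw, map_one]
    exact Unitary.coe_star_mul_self w
  have hKM : Kᴴ = M * Jᴴ := by
    have h1 : (w : EuclideanSpace ℂ n →L[ℂ] EuclideanSpace ℂ n) * star F = star G := by
      ext1 x
      rw [mul_apply_eq_comp, hw]
      exact hu x
    apply EquivLike.injective (Matrix.toEuclideanCLM (n := n) (𝕜 := ℂ))
    rw [map_mul, hMw, ← Matrix.star_eq_conjTranspose, ← Matrix.star_eq_conjTranspose, map_star,
      map_star, ← hF, ← hG, h1]
  refine ⟨⟨M, hMu⟩⁻¹, ?_⟩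
  rw [Matrix.UnitaryGroup.inv_val, Matrix.star_eq_conjTranspose, ← Matrix.conjTranspose_conjTranspose K, hKM,
    Matrix.conjTranspose_mul, Matrix.conjTranspose_conjTranspose]

/-- Consequently any `J` factors as `J = A · diag(σ) · B` with `A, B ∈ U(n)` and
`σᵢ = √λᵢ(J Jᴴ) ≥ 0` the singular values (`λ` = Mathlib's `IsHermitian.eigenvalues` of `J Jᴴ`, in its
enumeration): a **singular value decomposition** for square complex matrices (spectral theorem for
`J Jᴴ = A diag(λ) Aᴴ`, then the unitary freedom lemma for `Aᴴ J` and `diag(σ)`). [folklore] -/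
theorem exists_unitaryGroup_mul_diagonal_mul (J : Matrix n n ℂ) :
    ∃ A B : Matrix.unitaryGroup n ℂ, J = (A : Matrix n n ℂ) *
      Matrix.diagonal (fun i => ((Real.sqrt ((Matrix.isHermitian_mul_conjTranspose_self J).eigenvalues i)
        : ℝ) : ℂ)) * (B : Matrix n n ℂ) := by
  set hH := Matrix.isHermitian_mul_conjTranspose_self J with hhH
  have hP : (J * Jᴴ).PosSemidef := Matrix.posSemidef_self_mul_conjTranspose J
  set A : Matrix.unitaryGroup n ℂ := hH.eigenvectorUnitary with hA
  set S : Matrix n n ℂ := Matrix.diagonal (fun i => ((Real.sqrt (hH.eigenvalues i) : ℝ) : ℂ)) with hS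
  set D : Matrix n n ℂ := Matrix.diagonal (RCLike.ofReal ∘ hH.eigenvalues) with hD
  have hspec : J * Jᴴ = (A : Matrix n n ℂ) * D * (A : Matrix n n ℂ)ᴴ := by
    have := hH.spectral_theorem
    rw [Unitary.conjStarAlgAut_apply, Matrix.star_eq_conjTranspose] at this
    exact this
  have hSS : S * Sᴴ = D := by
    rw [hS, hD, Matrix.diagonal_conjTranspose, Matrix.diagonal_mul_diagonal]
    congr 1
    funext i
    have h0 : 0 ≤ hH.eigenvalues i := hP.eigenvalues_nonneg i
    simp only [Pi.star_apply, Complex.star_def, Complex.conj_ofReal, Function.comp_apply]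
    rw [← Complex.ofReal_mul, Real.mul_self_sqrt h0]
    rfl
  have hAu : (A : Matrix n n ℂ)ᴴ * (A : Matrix n n ℂ) = 1 := Matrix.UnitaryGroup.star_mul_self A
  have hAu' : (A : Matrix n n ℂ) * (A : Matrix n n ℂ)ᴴ = 1 := Matrix.mem_unitaryGroup_iff.1 A.2
  -- `J' = Aᴴ J` has `J' J'ᴴ = D = S Sᴴ`
  have hJ' : ((A : Matrix n n ℂ)ᴴ * J) * ((A : Matrix n n ℂ)ᴴ * J)ᴴ = S * Sᴴ := by
    rw [hSS, Matrix.conjTranspose_mul, Matrix.conjTranspose_conjTranspose]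
    calc (A : Matrix n n ℂ)ᴴ * J * (Jᴴ * (A : Matrix n n ℂ))
        = (A : Matrix n n ℂ)ᴴ * (J * Jᴴ) * (A : Matrix n n ℂ) := by simp only [Matrix.mul_assoc]
      _ = D := by
          rw [hspec]
          simp only [Matrix.mul_assoc]
          rw [hAu, Matrix.mul_one, ← Matrix.mul_assoc, hAu, Matrix.one_mul]
  obtain ⟨U, hU⟩ := exists_unitaryGroup_eq_mul_of_mul_conjTranspose_eq _ _ hJ'
  have hUu' : (U : Matrix n n ℂ) * (U : Matrix n n ℂ)ᴴ = 1 := Matrix.mem_unitaryGroup_iff.1 U.2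
  refine ⟨A, U⁻¹, ?_⟩
  rw [Matrix.UnitaryGroup.inv_val, Matrix.star_eq_conjTranspose, hU]
  simp only [Matrix.mul_assoc, hUu', Matrix.mul_one]
  rw [← Matrix.mul_assoc, hAu', Matrix.one_mul]

end GramFactor

section SingularValues

variable {N : ℕ}

/-- **The `U(N)` one-link integral depends on `J` only through `J Jᴴ`**: `J Jᴴ = K Kᴴ` implies
`W(J) = W(K)` (`K = J U` with `U` unitary, and right invariance). [folklore] -/
theorem oneLinkIntegral_unitaryGroup_eq_of_mul_conjTranspose_eq {J K : Matrix (Fin N) (Fin N) ℂ}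
    (h : J * Jᴴ = K * Kᴴ) :
    oneLinkIntegral (unitaryFundamentalRep (Fin N) ℂ) J =
      oneLinkIntegral (unitaryFundamentalRep (Fin N) ℂ) K := by
  obtain ⟨U, rfl⟩ := exists_unitaryGroup_eq_mul_of_mul_conjTranspose_eq J K h
  have h1 := oneLinkIntegral_unitaryGroup_mul_mul 1 U J
  rw [Submonoid.coe_one, Matrix.one_mul] at h1
  exact h1.symm

/-- Likewise through `Jᴴ J`: `Jᴴ J = Kᴴ K` implies `W(J) = W(K)` (apply the previous statement to
`Jᴴ`, `Kᴴ` and use `W(Jᴴ) = W(J)`). [folklore] -/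
theorem oneLinkIntegral_unitaryGroup_eq_of_conjTranspose_mul_eq {J K : Matrix (Fin N) (Fin N) ℂ}
    (h : Jᴴ * J = Kᴴ * K) :
    oneLinkIntegral (unitaryFundamentalRep (Fin N) ℂ) J =
      oneLinkIntegral (unitaryFundamentalRep (Fin N) ℂ) K := by
  rw [← oneLinkIntegral_unitaryGroup_conjTranspose J, ← oneLinkIntegral_unitaryGroup_conjTranspose K]
  apply oneLinkIntegral_unitaryGroup_eq_of_mul_conjTranspose_eq
  simpa only [Matrix.conjTranspose_conjTranspose] using h

/-- **Reduction to singular values**: `W_{U(N)}(J) = W_{U(N)}(diag(σ₁, …, σ_N))` with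
`σᵢ = √λᵢ(J Jᴴ)` the singular values of `J` — `W` is a (symmetric) function of the singular values
alone, the starting point of the character expansion `W(J) = Σ_r (α_r²/d_r) χ_r(J Jᴴ)`-type formulas
(Bars 1980; cf. Balantekin 2000 eq. (43) at `ν = 0`). [folklore] -/
theorem oneLinkIntegral_unitaryGroup_eq_diagonal_singularValues (J : Matrix (Fin N) (Fin N) ℂ) :
    oneLinkIntegral (unitaryFundamentalRep (Fin N) ℂ) J =
      oneLinkIntegral (unitaryFundamentalRep (Fin N) ℂ) (Matrix.diagonal fun i =>
        ((Real.sqrt ((Matrix.isHermitian_mul_conjTranspose_self J).eigenvalues i) : ℝ) : ℂ)) := by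
  obtain ⟨A, B, hJ⟩ := exists_unitaryGroup_mul_diagonal_mul J
  conv_lhs => rw [hJ]
  exact oneLinkIntegral_unitaryGroup_mul_mul A B _

/-- **The modulus of a baryonic harmonic depends on `J` only through `J Jᴴ`**:
`J Jᴴ = K Kᴴ` implies `|I_q(J)| = |I_q(K)|` (`K = J U`, covariance by the unit `conj(det U)^q`).
[folklore] -/
theorem norm_baryonicHarmonic_eq_of_mul_conjTranspose_eq (q : ℤ) {J K : Matrix (Fin N) (Fin N) ℂ}
    (h : J * Jᴴ = K * Kᴴ) : ‖baryonicHarmonic N q J‖ = ‖baryonicHarmonic N q K‖ := by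
  obtain ⟨U, rfl⟩ := exists_unitaryGroup_eq_mul_of_mul_conjTranspose_eq J K h
  have h1 := baryonicHarmonic_unitary_mul_mul 1 U q J
  rw [Submonoid.coe_one, Matrix.one_mul, Matrix.det_one, one_mul] at h1
  rw [h1, norm_mul, norm_zpow, norm_star, norm_det_coe_unitaryGroup, one_zpow, one_mul]

/-- **Phase–modulus factorisation of the baryonic harmonics**: along a singular value decomposition
`J = A diag(σ) B` (`exists_unitaryGroup_mul_diagonal_mul`),
`I_q(J) = conj(det A · det B)^q · I_q(diag(σ))`, where `I_q(diag σ)` is REAL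
(`baryonicHarmonic_im_of_conjTranspose_eq`) and `det A · det B = det J / ∏ σᵢ` is the phase
`e^{i arg det J}` when `J` is invertible — the form `W_{SU(N)} ∋ e^{-iq arg det J} w_q(σ)` used by the
requesting route. [folklore] -/
theorem baryonicHarmonic_eq_of_eq_mul_diagonal_mul (q : ℤ) {J : Matrix (Fin N) (Fin N) ℂ}
    {A B : Matrix.unitaryGroup (Fin N) ℂ} {σ : Fin N → ℝ}
    (hJ : J = (A : Matrix (Fin N) (Fin N) ℂ) * Matrix.diagonal (fun i => ((σ i : ℝ) : ℂ)) *
      (B : Matrix (Fin N) (Fin N) ℂ)) :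
    baryonicHarmonic N q J = star ((A : Matrix (Fin N) (Fin N) ℂ).det * (B : Matrix (Fin N) (Fin N) ℂ).det) ^ q *
      baryonicHarmonic N q (Matrix.diagonal fun i => ((σ i : ℝ) : ℂ)) := by
  rw [hJ]
  exact baryonicHarmonic_unitary_mul_mul A B q _

/-- `|I_q(J)| = |I_q(diag(σ(J)))|` with `σ` the singular values. [folklore] -/
theorem norm_baryonicHarmonic_eq_diagonal_singularValues (q : ℤ) (J : Matrix (Fin N) (Fin N) ℂ) :
    ‖baryonicHarmonic N q J‖ = ‖baryonicHarmonic N q (Matrix.diagonal fun i =>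
        ((Real.sqrt ((Matrix.isHermitian_mul_conjTranspose_self J).eigenvalues i) : ℝ) : ℂ))‖ := by
  obtain ⟨A, B, hJ⟩ := exists_unitaryGroup_mul_diagonal_mul J
  rw [baryonicHarmonic_eq_of_eq_mul_diagonal_mul q hJ, norm_mul, norm_zpow, norm_star, norm_mul,
    norm_det_coe_unitaryGroup, norm_det_coe_unitaryGroup, mul_one, one_zpow, one_mul]

/-- A real diagonal source is Hermitian, so its harmonics are real:
`Im I_q(diag(σ)) = 0`. [folklore] -/
theorem baryonicHarmonic_diagonal_im (q : ℤ) (σ : Fin N → ℝ) :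
    (baryonicHarmonic N q (Matrix.diagonal fun i => ((σ i : ℝ) : ℂ))).im = 0 := by
  apply baryonicHarmonic_im_of_conjTranspose_eq
  rw [Matrix.diagonal_conjTranspose]
  congr 1
  funext i
  simp only [Pi.star_apply, Complex.star_def, Complex.conj_ofReal]

end SingularValues

end Literature.MathematicalPhysics.QuantumLattice
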